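import Literature.Topology.FourManifolds.CircleSurgeryEuler
import Literature.Topology.FourManifolds.CircleSurgeryEulerCharacteristic
import Literature.Topology.FourManifolds.CircleSurgerySimplyConnected
import HarnessLib

/-!
# Proof: a circle surgery in dimension four raises the Euler characteristic by two

Sibling proof file of `Literature/Topology/FourManifolds/CircleSurgeryEuler.lean` (D-0014: the
named fact `def X : Prop` is discharged as `theorem X_holds : X`).  It PROVES
`Literature.Topology.FourManifolds.circleSurgery_relEuler_eq_add_two_holds :
circleSurgery_relEuler_eq_add_two` — if the closed smooth `4`-manifold `M` is obtained from the
closed smooth `4`-manifold `X` by surgery on a smoothly embedded circle `c`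
(`Literature.Topology.FourManifolds.IsCircleSurgery`, either framing), then
`χ(M) = χ(X) + 2`, `χ` being the tree's `relEuler ℤ ℤ · ∅` (Kosinski 1993, VI (9.2)/(10.1) and
VII §1: trace `= X × I ∪ 2-handle = M × I ∪ 3-handle`; Kirby 1989, Ch. I §2 p. 7: surgery on a
circle switches a `1`-handle to a `2`-handle).

## Proof (Mayer–Vietoris / excision counts over two open covers; no handles, no orientations)

Let `ν : 𝕊¹ × ℝ³ ↪ X` be the tube of the surgery presentation and `j_A : X ∖ c → M`,
`j_B : D̊² × 𝕊² → M` its gluing maps.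
* `X = (X ∖ c) ∪ ν(𝕊¹ × ℝ³)` with overlap `ν(𝕊¹ × (ℝ³ ∖ 0))`.  The second piece is
  `≅ 𝕊¹ × ℝ³` and the overlap `≅ 𝕊¹ × (ℝ³ ∖ 0) ≃ 𝕊¹ × 𝕊²`, both of Euler characteristic `0`
  (the tree's models `finRelHomology_sphereOne_prod_space`, `finRelHomology_puncturedTube` of
  `CircleSurgeryEulerModels.lean`), so `χ(X, X ∖ c) = 0 − 0` (`finRelHomology_pair_of_isOpen_cover`: the triple
  `∅ ⊆ overlap ⊆ piece` and excision, Hatcher §2.1 p. 118, Thm. 2.20) and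
  `χ(X ∖ c) = χ(X) − χ(X, X ∖ c) = χ(X)` (`finRelHomology_subset_of_pair`; the homology of the
  closed manifold `X` is of finite type, `finite_singularHomology_of_compactSpace_holds`,
  `isZero_singularHomology_of_lt_holds`) — in particular `X ∖ c` has homology of finite type.
* `M = j_A(X ∖ c) ∪ j_B(D̊² × 𝕊²)` with overlap `j_B((D̊² ∖ 0) × 𝕊²)`
  (`range_inter_range_eq_of_circleSurgeryRel`); `D̊² × 𝕊² ≃ 𝕊²` has `χ = 2`
  (`finRelHomology_discTimesSphere`) and `(D̊² ∖ 0) × 𝕊² ≃ 𝕊¹ × 𝕊²` has `χ = 0`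
  (`finRelHomology_puncturedCore`), so `χ(M) = χ(X ∖ c) + 2 − 0 = χ(X) + 2`
  (`finRelHomology_and_relEuler_of_isOpen_cover_gen`).
The tree already has the universe-`0` statement `finRelHomology_and_relEuler_of_isCircleSurgery`
(`CircleSurgeryEulerCharacteristic.lean`); the named fact quantifies over `Type u`, so the
Mayer–Vietoris counts (`finRelHomology_and_relEuler_of_isOpen_cover`,
`finRelHomology_left_and_relEuler_of_isOpen_cover`, universe `0`, coefficients `ℤ`) are re-proved
here for any universe and any Noetherian coefficient ring, and the universe-`0` model spaces are
moved into `Type u` along homeomorphisms (`FinRelHomology.of_homeomorph`,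
`relEuler_eq_of_homeomorph`, which allow different universes).  Everything is proved; no
definition and no named fact is introduced.

## References

* [Kosinski1993] A. Kosinski, *Differential Manifolds* (1993), Ch. VI (9.2), (10.1); Ch. VII §1.
* [Kirby1989] R. Kirby, *The Topology of 4-Manifolds* (1989), Ch. I §2, p. 7.
* [HatcherAT2002] A. Hatcher, *Algebraic Topology* (2002), §2.1 p. 118, Thm. 2.20, Cor. 2.11,
  §2.2 Thm. 2.44, Thm. 2.26.
-/

noncomputable section

open Set Function CategoryTheory CategoryTheory.Limits Module
open scoped Manifold ContDiff Topology
open Literature.AlgebraicTopology.SingularHomology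

namespace Literature.Topology.FourManifolds

universe u v

/-! ### The Mayer–Vietoris Euler count for an open cover (any universe, any coefficients) -/

section OpenCover

variable (R : Type v) [CommRing R] (M : Type v) [AddCommGroup M] [Module R M]
  [IsNoetherianRing R] [HasRankNullity.{max u v} R]
  {P : Type u} [TopologicalSpace P]

/-- **`χ(P, U) = χ(V) − χ(U ∩ V)` with finiteness, for an open cover `P = U ∪ V`** whose pieces
`V`, `U ∩ V` have homology of finite type (Hatcher 2002, §2.1 p. 118 and Thm. 2.20: the triple
`∅ ⊆ U ∩ V ⊆ V` in `V` and excision `H_•(V, U ∩ V) ≅ H_•(P, U)`; the first half of the tree's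
`Literature.Topology.FourManifolds.finRelHomology_and_relEuler_of_isOpen_cover`, here for any
universe and any Noetherian coefficient ring). [cite: HatcherAT2002, §2.1 p. 118 and Thm. 2.20] -/
theorem finRelHomology_pair_of_isOpen_cover {U V : Set P} (hU : IsOpen U) (hV : IsOpen V)
    (hUV : U ∪ V = univ) {N : ℕ} (hFV : FinRelHomology R M ↥V ∅ N)
    (hFUV : FinRelHomology R M ↥(U ∩ V) ∅ N) :
    FinRelHomology R M P U (N + 1) ∧
      relEuler R M P U = relEuler R M ↥V ∅ - relEuler R M ↥(U ∩ V) ∅ := by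
  have hint : interior U ∪ interior V = univ := by rw [hU.interior_eq, hV.interior_eq, hUV]
  let e : ↥(U ∩ V) ≃ₜ ↥(Subtype.val ⁻¹' U : Set ↥V) :=
    (Homeomorph.setCongr (inter_comm U V)).trans (preimageValHomeomorph V U).symm
  have hW : FinRelHomology R M ↥(Subtype.val ⁻¹' U : Set ↥V) (Subtype.val ⁻¹' ∅) N :=
    (hFUV.of_homeomorph e (mapsTo_empty _ _) (mapsTo_empty _ _)).congr_set (preimage_empty).symm
  have hWe : relEuler R M ↥(Subtype.val ⁻¹' U : Set ↥V) (Subtype.val ⁻¹' ∅) =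
      relEuler R M ↥(U ∩ V) ∅ := by
    rw [relEuler_congr_set (R := R) (M := M) (X := ↥(Subtype.val ⁻¹' U : Set ↥V))
      (preimage_empty (f := (Subtype.val : ↥(Subtype.val ⁻¹' U : Set ↥V) → ↥V)))]
    exact (relEuler_eq_of_homeomorph (R := R) (M := M) (A := (∅ : Set ↥(U ∩ V))) e
      (mapsTo_empty _ _) (mapsTo_empty _ _)).symm
  obtain ⟨hVW, hVWe⟩ := FinRelHomology.triple_right (R := R) (M := M)
    (empty_subset (Subtype.val ⁻¹' U : Set ↥V)) hW hFV
  have hexc := relativeSingularHomology.isIso_map_of_interior_union_interior_holds R M P U V hint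
  let ex : ∀ k, relativeSingularHomology R M ↥V (Subtype.val ⁻¹' U) k ≅
      relativeSingularHomology R M P U k := fun k =>
    @asIso _ _ _ _ (relativeSingularHomology.map R M (X := ↥V) (subsetIncl V)
      (mapsTo_preimage Subtype.val U : MapsTo _ (Subtype.val ⁻¹' U) U) k) (hexc k)
  refine ⟨hVW.of_iso ex, ?_⟩
  rw [← relEuler_eq_of_iso ex, ← hWe]
  linarith

/-- **`χ(U ∪ V) = χ(U) + χ(V) − χ(U ∩ V)` with finiteness, for an open cover with pieces of
finite homological type** (Hatcher 2002, Thm. 2.44 via the triples `∅ ⊆ U ⊆ P`,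
`∅ ⊆ U ∩ V ⊆ V` and excision; the tree's
`Literature.Topology.FourManifolds.finRelHomology_and_relEuler_of_isOpen_cover` for any universe
and any Noetherian coefficient ring). [cite: HatcherAT2002, §2.2 Thm. 2.44 (proof), §2.1 p. 118, Thm. 2.20] -/
theorem finRelHomology_and_relEuler_of_isOpen_cover_gen {U V : Set P} (hU : IsOpen U)
    (hV : IsOpen V) (hUV : U ∪ V = univ) {N : ℕ} (hFU : FinRelHomology R M ↥U ∅ N)
    (hFV : FinRelHomology R M ↥V ∅ N) (hFUV : FinRelHomology R M ↥(U ∩ V) ∅ N) :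
    FinRelHomology R M P ∅ (N + 1) ∧
      relEuler R M P ∅ = relEuler R M ↥U ∅ + relEuler R M ↥V ∅ - relEuler R M ↥(U ∩ V) ∅ := by
  obtain ⟨hPU, hPUe⟩ := finRelHomology_pair_of_isOpen_cover R M hU hV hUV hFV hFUV
  have hU' : FinRelHomology R M ↥U (Subtype.val ⁻¹' ∅) (N + 1) :=
    (hFU.mono (Nat.le_succ N)).congr_set (preimage_empty).symm
  obtain ⟨hPfin, hPe⟩ := FinRelHomology.triple_mid (R := R) (M := M) (empty_subset U) hU' hPU
  refine ⟨hPfin, ?_⟩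
  rw [hPe, relEuler_congr_set (R := R) (M := M) (X := ↥U)
    (preimage_empty (f := (Subtype.val : ↥U → P))), hPUe]
  ring

/-- **`χ(U) = χ(P) − χ(P, U)` with finiteness**: a subspace of a space of finite type with
relative homology of finite type has homology of finite type (triple `∅ ⊆ U ⊆ P`, Hatcher 2002,
§2.1 p. 118 and Thm. 2.44). [cite: HatcherAT2002, §2.1 p. 118 and §2.2 Thm. 2.44] -/
theorem finRelHomology_subset_of_pair {U : Set P} {N : ℕ} (hP : FinRelHomology R M P ∅ N)
    (hPU : FinRelHomology R M P U N) :
    FinRelHomology R M ↥U ∅ N ∧ relEuler R M ↥U ∅ = relEuler R M P ∅ - relEuler R M P U := by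
  obtain ⟨hA, hAe⟩ := FinRelHomology.triple_left (R := R) (M := M) (empty_subset U) hP hPU
  refine ⟨hA.congr_set preimage_empty, ?_⟩
  rw [relEuler_congr_set (R := R) (M := M) (X := ↥U)
    (preimage_empty (f := (Subtype.val : ↥U → P)))] at hAe
  linarith

end OpenCover

/-! ### The theorem -/

section Main

open _root_.Topology (IsOpenEmbedding IsEmbedding)

/-- **Euler characteristic of a circle surgery in dimension four, PROVED — discharge of the
named fact `Literature.Topology.FourManifolds.circleSurgery_relEuler_eq_add_two`**
(`CircleSurgeryEuler.lean`; Kosinski 1993, VI (9.2)/(10.1), VII §1; Kirby 1989, Ch. I §2 p. 7):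
if the closed smooth `4`-manifold `M` is obtained from the closed smooth `4`-manifold `X` by
surgery on a smoothly embedded circle `c` (`IsCircleSurgery`, either framing), then
`χ(M) = χ(X) + 2` for `χ = relEuler ℤ ℤ · ∅`.  Proof (module docstring): the open covers
`X = (X ∖ c) ∪ ν(𝕊¹ × B̊³)` and `M = j_A(X ∖ c) ∪ j_B(D̊² × 𝕊²)`, whose second pieces and overlaps
have Euler characteristics `0, 0` and `2, 0`, and the Mayer–Vietoris / excision counts
`χ(X ∖ c) = χ(X) − χ(X, X ∖ c) = χ(X) − (0 − 0)` and `χ(M) = χ(X ∖ c) + 2 − 0`.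
[cite: Kosinski1993, Ch. VI (9.2), (10.1); Ch. VII §1 Prop. (1.1)] [cite: Kirby1989, Ch. I §2 (p. 7)] -/
theorem circleSurgery_relEuler_eq_add_two_holds : circleSurgery_relEuler_eq_add_two.{u} := by
  intro X _ _ _ _ _ _ c hc M _ _ _ _ _ _ hs
  haveI := Fact.mk (@finrank_euclideanSpace_fin ℝ _ 2)
  haveI := Fact.mk (@finrank_euclideanSpace_fin ℝ _ 3)
  haveI := Fact.mk (@finrank_euclideanSpace_fin ℝ _ 4)
  obtain ⟨ν, jA, jB, hA, hAo, hB, hBo, hU, hR⟩ := hs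
  have hν : IsOpenEmbedding ν.toFun := ⟨ν.isSmoothEmbedding.isEmbedding, ν.isOpen_range⟩
  have hA' : IsOpenEmbedding jA := ⟨hA.isEmbedding, hAo⟩
  have hB' : IsOpenEmbedding jB := ⟨hB.isEmbedding, hBo⟩
  -- the open cover `X = (X ∖ c) ∪ ν(S¹ × ℝ³)` and its overlap `ν(S¹ × (ℝ³ ∖ 0))`
  set Uc : Set X := ((ν.complement : TopologicalSpace.Opens X) : Set X) with hUc
  set V : Set X := range ν.toFun with hV
  have hUo : IsOpen Uc := ν.complement.isOpen
  have hVo : IsOpen V := ν.isOpen_range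
  have hmemU : ∀ x, x ∈ Uc ↔ x ∉ range c := fun x => Iff.rfl
  have hcov : Uc ∪ V = univ := by
    refine eq_univ_of_forall fun x => ?_
    by_cases hx : x ∈ range c
    · obtain ⟨u, rfl⟩ := hx
      exact Or.inr ⟨(u, 0), ν.apply_zero u⟩
    · exact Or.inl ((hmemU x).2 hx)
  have hUV : Uc ∩ V = ν.toFun ''
      ((univ : Set (Metric.sphere (0 : EuclideanSpace ℝ (Fin 2)) 1)) ×ˢ ({0}ᶜ : Set (EuclideanSpace ℝ (Fin 3)))) := by
    ext x
    constructor
    · rintro ⟨hxU, ⟨⟨u, w⟩, rfl⟩⟩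
      refine ⟨(u, w), ⟨mem_univ _, fun hw0 => (hmemU _).1 hxU ?_⟩, rfl⟩
      rw [mem_singleton_iff] at hw0
      subst hw0
      exact ⟨u, (ν.apply_zero u).symm⟩
    · rintro ⟨⟨u, w⟩, ⟨-, hw0⟩, rfl⟩
      refine ⟨(hmemU _).2 fun hmem => hw0 ?_, ⟨(u, w), rfl⟩⟩
      obtain ⟨u', hu'⟩ := hmem
      rw [← ν.apply_zero] at hu'
      exact (congrArg Prod.snd (hν.injective hu')).symm
  -- the pieces `V ≅ S¹ × ℝ³` (`χ = 0`) and `Uc ∩ V ≅ S¹ × (ℝ³ ∖ 0)` (`χ = 0`)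
  let eV : ((Metric.sphere (0 : EuclideanSpace ℝ (Fin 2)) 1) × EuclideanSpace ℝ (Fin 3)) ≃ₜ ↥V := hν.isEmbedding.toHomeomorph
  let eUV : ↥((univ : Set (Metric.sphere (0 : EuclideanSpace ℝ (Fin 2)) 1)) ×ˢ ({0}ᶜ : Set (EuclideanSpace ℝ (Fin 3)))) ≃ₜ ↥(Uc ∩ V) :=
    (hν.isEmbedding.homeomorphImage _).trans (Homeomorph.setCongr hUV).symm
  obtain ⟨hmV, hχmV⟩ := finRelHomology_sphereOne_prod_space
  obtain ⟨hmUV, hχmUV⟩ := finRelHomology_puncturedTube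
  have hFV : FinRelHomology ℤ ℤ ↥V ∅ 2 := hmV.of_homeomorph eV (mapsTo_empty _ _) (mapsTo_empty _ _)
  have hχV : relEuler ℤ ℤ ↥V ∅ = 0 := by
    rw [← hχmV]
    exact (relEuler_eq_of_homeomorph (R := ℤ) (M := ℤ)
      (A := (∅ : Set ((Metric.sphere (0 : EuclideanSpace ℝ (Fin 2)) 1) × EuclideanSpace ℝ (Fin 3)))) eV (mapsTo_empty _ _) (mapsTo_empty _ _)).symm
  have hFUV : FinRelHomology ℤ ℤ ↥(Uc ∩ V) ∅ 4 :=
    hmUV.of_homeomorph eUV (mapsTo_empty _ _) (mapsTo_empty _ _)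
  have hχUV : relEuler ℤ ℤ ↥(Uc ∩ V) ∅ = 0 := by
    rw [← hχmUV]
    exact (relEuler_eq_of_homeomorph (R := ℤ) (M := ℤ)
      (A := (∅ : Set ↥((univ : Set (Metric.sphere (0 : EuclideanSpace ℝ (Fin 2)) 1)) ×ˢ ({0}ᶜ : Set (EuclideanSpace ℝ (Fin 3)))))) eUV
      (mapsTo_empty _ _) (mapsTo_empty _ _)).symm
  -- `χ(X, X ∖ c) = 0`, hence `χ(X ∖ c) = χ(X)` (and `X ∖ c` has homology of finite type)
  obtain ⟨hXU, hχXU⟩ := finRelHomology_pair_of_isOpen_cover ℤ ℤ hUo hVo hcov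
    (hFV.mono (by norm_num : 2 ≤ 4)) hFUV
  have hX : FinRelHomology ℤ ℤ X ∅ 5 :=
    FinRelHomology.empty_of_absolute
      (fun j => finite_singularHomology_of_compactSpace_holds ℤ X 4 j)
      (fun _ hj => isZero_singularHomology_of_lt_holds ℤ ℤ X 4 (by omega))
  obtain ⟨hFU, hχU⟩ := finRelHomology_subset_of_pair ℤ ℤ hX hXU
  -- the open cover of `M` by `jA(X ∖ c)` and `jB(D̊² × S²)`, overlap `jB((D̊² ∖ 0) × S²)`
  have eU : ↥Uc ≃ₜ ↥(range jA) := hA'.isEmbedding.toHomeomorph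
  have hFU' : FinRelHomology ℤ ℤ ↥(range jA) ∅ 5 :=
    hFU.of_homeomorph eU (mapsTo_empty _ _) (mapsTo_empty _ _)
  have hχU' : relEuler ℤ ℤ ↥(range jA) ∅ = relEuler ℤ ℤ ↥Uc ∅ :=
    (relEuler_eq_of_homeomorph (R := ℤ) (M := ℤ) (A := (∅ : Set ↥Uc)) eU
      (mapsTo_empty _ _) (mapsTo_empty _ _)).symm
  let eT : ↥discTimesSphere ≃ₜ ↥(range jB) := hB'.isEmbedding.toHomeomorph
  obtain ⟨hmT, hχmT⟩ := finRelHomology_discTimesSphere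
  have hFT : FinRelHomology ℤ ℤ ↥(range jB) ∅ 3 := hmT.of_homeomorph eT (mapsTo_empty _ _) (mapsTo_empty _ _)
  have hχT : relEuler ℤ ℤ ↥(range jB) ∅ = 2 := by
    rw [← hχmT]
    exact (relEuler_eq_of_homeomorph (R := ℤ) (M := ℤ) (A := (∅ : Set ↥discTimesSphere)) eT
      (mapsTo_empty _ _) (mapsTo_empty _ _)).symm
  have hUT : range jA ∩ range jB = jB '' {b : ↥discTimesSphere | b.1.1 ≠ 0} :=
    range_inter_range_eq_of_circleSurgeryRel hR
  let eUT : ↥{b : ↥discTimesSphere | b.1.1 ≠ 0} ≃ₜ ↥(range jA ∩ range jB) :=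
    (hB'.isEmbedding.homeomorphImage _).trans (Homeomorph.setCongr hUT).symm
  obtain ⟨hmUT, hχmUT⟩ := finRelHomology_puncturedCore
  have hFUT : FinRelHomology ℤ ℤ ↥(range jA ∩ range jB) ∅ 4 :=
    hmUT.of_homeomorph eUT (mapsTo_empty _ _) (mapsTo_empty _ _)
  have hχUT : relEuler ℤ ℤ ↥(range jA ∩ range jB) ∅ = 0 := by
    rw [← hχmUT]
    exact (relEuler_eq_of_homeomorph (R := ℤ) (M := ℤ)
      (A := (∅ : Set ↥{b : ↥discTimesSphere | b.1.1 ≠ 0})) eUT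
      (mapsTo_empty _ _) (mapsTo_empty _ _)).symm
  obtain ⟨-, hχM⟩ := finRelHomology_and_relEuler_of_isOpen_cover_gen ℤ ℤ hAo hBo hU hFU'
    (hFT.mono (by norm_num : 3 ≤ 5)) (hFUT.mono (by norm_num : 4 ≤ 5))
  rw [hχM, hχU', hχU, hχXU, hχV, hχUV, hχT, hχUT]
  ring

end Main

end Literature.Topology.FourManifolds

end
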